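import Literature.MathematicalPhysics.QuantumFieldTheory.Balaban1983to89.B6Cor28EntriesKLevelV1
import Literature.MathematicalPhysics.QuantumFieldTheory.Balaban1983to89.B6Cor28HolderKLevelV1
import Literature.MathematicalPhysics.QuantumFieldTheory.Balaban1983to89.B6Prop27PrintedKLevelV1
import Literature.MathematicalPhysics.QuantumFieldTheory.Balaban1983to89.B6KLevelCensusIndexV1
import Literature.MathematicalPhysics.QuantumFieldTheory.Balaban1983to89.B6KLevelCensusBookkeepingV1
import Literature.MathematicalPhysics.QuantumFieldTheory.Balaban1983to89.B3TorusRadialSums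
import HarnessLib

/-!
# `Balaban1983to89.B6Cor28PrintedKLevelV1` — T. Bałaban, *Propagators and renormalization transformations for lattice gauge theories. II*,
Comm. Math. Phys. **96** (1984) 223–250 [Balaban1984PropagatorsII], p. 249 **COROLLARY 2.8 (2.150)–(2.151) — THE VERBATIM CENSUS TYPING `…B6.Cor28Printed`
INHABITED ON THE GENUINE k-LEVEL V1 FAMILY MODULO ONE DISPLAYED INPUT, the (2.137)₁ majorant `h2137`** (B6-CLOSURE §5 item 20, census file; owner r03): on the index/geometry of
`B6KLevelCensusIndexV1` (`KIdx`, `kGeo`: `Site := 𝔅`, `len = L^{j}/|c_f|`, `dist = d_T(β·,β·)`, cut-offs = functions on the fine bonds with the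
Hölder-pair readings `cutIn`/`cutH = |ζ| + ‖ζ‖^ξ_α`), the kernel family `kH` reads `|H(b,c)|`, `|(∇H)(b,c)|` (sup over the fine bonds `b` of the block of the
site) and `‖(ζ∇H)(·,c)‖_α` (sup over admissible ordered pairs of the Hölder quotient `|x − x′|_phys^{−α}|ζ(x)(∇_νH)(x,c) − ζ(x′)(∇_νH)(x′,c)|`) of the genuine
`H = GE ∘ QsE ∘ EE` in PRINT'S kernel normalisation `H(b,c) = (L^{j(c)}η)^{−D}·(flat entry)` of (2.150); the three entries are fed by
`B6Cor28EntriesKLevelV1.cor28_kLevel_H_DH` ((2.151)₁,₂) BY NAME and `B6Cor28HolderKLevelV1.cor28_kLevel_holderPair_of_2137` ((2.151)₃, per admissible pair) BY NAME —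
the latter MODULO the displayed (2.137)₁ input `h2137` (Prop. 2.6 (2.137)₁ `‖ζ∇GJ‖_α` at k levels for the genuine `G`, «M sufficiently large» uniform in
the Hölder exponent, in the exact shape p22's programme `B6Ineq2137GradKLevelV1.holderLegs_kLevel` + `B6Prop26HolderGradKLevelV1.prop26_2137_grad_kLevel_of_legs`
produces; the hypothesis-free corollary `cor28Printed_kLevel` follows in the sequel `B6Cor28HolderUnifKLevelV1` once `B6Ineq2137GradKLevelV1` has landed).

HONEST FRAMING (programme rule): statement-level skeleton of published theorems with citation tags; proofs where landed; nothing here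
is a claim about the Yang–Mills mass gap.

PRINT (verbatim, p. 249, = the docstring of `…B6.Cor28Printed`): «Corollary 2.8. A kernel of the operator H, (HB)(b) = Σ_{c∈𝔅}(L^{j(c)}η)^d H(b,c)B(c),
(2.150) satisfies the inequality |H(b,c)|, |(∇H)(b,c)|, ‖(ζ∇H)(·,c)‖_α ≤ O(1)[1, (L^jη)^{−1}, (L^jη)^{−1−α}(‖ζ‖^ξ_α + |ζ|)](L^{j′}η)^{−d}e^{−δ₅d(y,c₋)},
(1.151)[sic] b ∈ Δ(y) or supp ζ ⊂ Δ(y), y ∈ Λ_j, c₋ ∈ Λ_{j′}.»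

## WHAT THIS FILE CERTIFIES (kernel-checked, sorry-free, standard axioms)

* §1 readings: `Hfl`/`DHfl` (flat entries of `H`/`∇_νH` against `e_c`), `vol` (`(L^{j(c)}η)^D`, `η = |c_f|⁻¹`), `kH i : B6.HFamily (kGeo i)`;
* §2 bookkeeping: `len_rpow_neg_D` (`len c^{−D} = vol⁻¹`), `len_eq_lenT`; the adjacent-block comparison `adjLen_le` ((2.60): two blocks at torus distance
  `≤ 1` differ by at most the factor `L²e` in `(length)^{−(1+α)}`), `exp_adj_le` ((2.54)), `quot_cancel`, `eq_of_supDist_eq_zero` are imported from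
  `B6KLevelCensusBookkeepingV1` (shared with the Prop. 2.6 census);
* §3 **`cor28Printed_kLevel_of_2137 (hb₀) (hb₁) (h2137 : …) : B6.Cor28Printed (d + 1) (fun i : KIdx d ℓ hd hL b₀ b₁ => kGeo i) (fun i => kH i)`** for every `d`,
  odd `L ≥ 5` and band `0 < b₀ ≤ b₁`, modulo the displayed (2.137)₁ input — witnesses: ONE threshold `M₁ = max (max M_a M_b) (max (N_a+1) (N_b+1))` of the thresholds of the two inputs at `σ := min σ_a σ_b`, rate
  `α_r := ½` (uniform in the Hölder exponent), `δ₅ = min δ_a δ_b`, `C = max C_a 1`, `Cα(α) = 2·max(C_a, C_b(α))·(L²e)²·e^{δ_b}` (`C_b(α)` by choice from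
  the input's `∃ C`; junk outside `[0,1)`); the Hölder clause by cases on the support of `ζ` at the two points of the pair (both zero / `ζ(x) = 0 ≠ ζ(x′)`:
  reversed pair at the block of `x′` / `ζ(x) ≠ 0`: product rule at the block of `x`), no cube geometry needed;
* §4 non-vacuity: `B6Prop27PrintedKLevelV1.kLevel27_meets_hypotheses` (by name; not re-exported).

## HONEST SCOPE

(1) READINGS (ours, documented in `B6KLevelCensusIndexV1.kGeo`): `b ∈ Δ(y)` = the fine bonds of the block `β y`; admissible pairs = p22's symmetric
condition (same direction, `|x − x′|_∞ ≤ L^{j(y(x))}`, `≤ L^{j(y(x′))}`), Hölder quotient with `|x − x′|_phys = |x − x′|_∞·η`, `‖ζ‖^ξ_α` with the quotient at the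
scale of the first point's block; `supp ζ ⊂ Δ̃(y)` = blocks within torus distance 1 of `β y`.  (2) Constants `C`, `Cα`, `δ₅` depend on `d, L` AND the band
`b₀, b₁` (print: `d, L`; `α` for `Cα`).  (3) Family = the V1 torus family of ROUTE V/W (`k ≥ 2`; non-vacuity certified at `L = 5`).  (4) Flat `ℓ²` model;
the expansion form of `H` is not re-derived.  DEFINITIONS (readings) + THEOREMS; no `def … : Prop`.  NOT summit progress.  Unit `lit-balaban-r03` (gens 25–26),
2026-08-24/25 (gen 26c: the (2.137)₁ input displayed; discharge in the sequel).
-/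

noncomputable section

open scoped InnerProductSpace

namespace Literature.MathematicalPhysics.QuantumFieldTheory.Balaban1983to89.B6Cor28PrintedKLevelV1

open LatticeFieldCalculus
open B6SectAOperatorsV1 (QE QsE BondIdx BondIdxSpace)
open B6SectAVectorModelV1 (GE EE)
open B6Ineq2133TwoScaleV1 (onFun)
open B6MultiLevelBoxOperator (N0)
open B6MultiLevelTorusOperator (TDomains)
open B6GlobalChartV1 (PV domT blkV1)
open B6Geom246MultiLevelBox (bset)
open B6Ineq281MultiLevelBox (lgap)
open B6Geom246MultiLevelTorus (geomT triangle_refl_nonneg_T)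
open B8Ineq192MultiLevelTorus (lenT_eq lenT_pos symmT)
open B6Ineq2142KLevelV1 (lvl β beta_level)
open B6GradLegKLevelV1 (DV)
open B6HolderPairMemberV1 (pairOp abs_cutoff_pair_le)
open B6RandomWalk (HasMajorant delta3)
open B6Cor28KLevelV1 (two_le_RMh powL_lgap_le level_le_lgap_add lgap_comm one_le_L)
open B6Prop26KLevelAssemblyV1 (distT_nonneg)
open B6CubeWindowV1 (Placed GlobalBand)
open B6Cover236MultiLevelBlocks (cubes)
open B6KLevelCensusIndexV1 (KIdx kGeo Adm tpar len_eq len_pos)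
open B6KLevelCensusBookkeepingV1 (len_compare quot_cancel adjLen_le exp_adj_le eq_of_supDist_eq_zero)
open B6Cor28EntriesKLevelV1 (cor28_kLevel_H_DH)
open B6Cor28HolderKLevelV1 (cor28_kLevel_holderPair_of_2137)
open B3TorusRadialSums (supDist_eq_zero_iff supDist_comm)

variable {d ℓ : ℕ} {hd : 1 ≤ d + 1} {hL : Odd (ℓ + 1) ∧ 1 < ℓ + 1} {b₀ b₁ : ℝ}

/-! ## §1  The readings of the kernel family -/

/-- the FLAT entry `⟪e_f, He_c⟫` of the genuine `H = GE ∘ QsE ∘ EE`. [cite: Balaban1984PropagatorsII, (2.130) p.246, (2.150) p.249] -/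
def Hfl (i : KIdx d ℓ hd hL b₀ b₁) (c : BondIdx (domT i.hN i.D i.hk)) (f : PBond (PV d ℓ i.m i.K hd hL) 0) : ℝ :=
  (GE (domT i.hN i.D i.hk) i.hcf i.hw ∘ₗ QsE (domT i.hN i.D i.hk) ∘ₗ EE (domT i.hN i.D i.hk) i.hcf i.hw) (EuclideanSpace.single c (1 : ℝ)) f

/-- the FLAT entry `(∇_νHe_c)(f)`. [cite: Balaban1984PropagatorsII, (2.150)–(2.151) p.249] -/
def DHfl (i : KIdx d ℓ hd hL b₀ b₁) (ν : Fin (d + 1)) (c : BondIdx (domT i.hN i.D i.hk)) (f : PBond (PV d ℓ i.m i.K hd hL) 0) : ℝ :=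
  (DV (P := PV d ℓ i.m i.K hd hL) ν i.cf ∘ₗ
    onFun (GE (domT i.hN i.D i.hk) i.hcf i.hw ∘ₗ QsE (domT i.hN i.D i.hk) ∘ₗ EE (domT i.hN i.D i.hk) i.hcf i.hw)) (Pi.single c 1) f

/-- print's (2.150) volume of the input bond `c`: `(L^{j(c)}η)^D`, `η = |c_f|⁻¹`. [cite: Balaban1984PropagatorsII, (2.150) p.249, (2.69) p.235] -/
def vol (i : KIdx d ℓ hd hL b₀ b₁) (c : BondIdx (domT i.hN i.D i.hk)) : ℝ :=
  ((((ℓ + 1 : ℕ) : ℝ)) ^ (lvl i.hN i.D i.hk c) / |i.cf|) ^ (d + 1)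

/-- **the kernel family of Cor. 2.8 read on the genuine k-level `H`** in print's normalisation `H(b,c) = (L^{j(c)}η)^{−D}·⟪e_b, He_c⟫`: `e 0 y c` /
`e 1 y c` = sup over the fine bonds `b` of the block of `y` (and the directions) of `|H(b,c)|` / `|(∇_νH)(b,c)|`; `h α ζ c` = sup over the directions and
the admissible ordered pairs `(x, x′)` of `(|x − x′|_∞·η)^{−α}·|ζ(x)(∇_νH)(x,c) − ζ(x′)(∇_νH)(x′,c)|`. [cite: Balaban1984PropagatorsII, Cor. 2.8 (2.150)–(2.151) p.249; Balaban1984PropagatorsI, (1.109) p.35] -/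
def kH (i : KIdx d ℓ hd hL b₀ b₁) : B6.HFamily (kGeo i) where
  e := fun n y c => ⨆ ν : Fin (d + 1), ⨆ f : PBond (PV d ℓ i.m i.K hd hL) 0,
    if blkV1 i.hN i.D f = β i.hN i.D i.hk y then (if n = 0 then |Hfl i c f| else |DHfl i ν c f|) * (vol i c)⁻¹ else 0
  h := fun α ζ c => ⨆ ν : Fin (d + 1), ⨆ q : PBond (PV d ℓ i.m i.K hd hL) 0 × PBond (PV d ℓ i.m i.K hd hL) 0,
    if Adm i q.1 q.2 then (((supDist q.1.src q.2.src : ℕ) : ℝ) * |i.cf|⁻¹) ^ (-α) * |ζ q.1 * DHfl i ν c q.1 - ζ q.2 * DHfl i ν c q.2| * (vol i c)⁻¹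
    else 0

/-! ## §2  Bookkeeping -/

/-- `vol c = len(c)^D` as a real power: `len c ^ (−D) = (vol c)⁻¹`. [cite: Balaban1984PropagatorsII, (2.150) p.249, bookkeeping] -/
theorem len_rpow_neg_D (i : KIdx d ℓ hd hL b₀ b₁) (c : BondIdx (domT i.hN i.D i.hk)) :
    (kGeo i).len c ^ (-((d + 1 : ℕ) : ℝ)) = (vol i c)⁻¹ := by
  rw [Real.rpow_neg (len_pos i c).le, Real.rpow_natCast, len_eq]; rfl

/-- `len(y) = len_T(β y)·|c_f|⁻¹` (the census length of an index bond is the physical length of its block). [cite: Balaban1984PropagatorsII, (2.1) p.224, bookkeeping] -/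
theorem len_eq_lenT (i : KIdx d ℓ hd hL b₀ b₁) (y : BondIdx (domT i.hN i.D i.hk)) :
    (kGeo i).len y = (geomT i.D).len (β i.hN i.D i.hk y) * |i.cf|⁻¹ := by
  rw [len_eq, lenT_eq, beta_level i.hN i.D i.hk (le_trans one_le_two i.hk2), div_eq_mul_inv]
  push_cast; ring


/-! ## §3  Corollary 2.8 verbatim on the genuine k-level family -/

-- one long assembly (three entries, four cases of the cut-off support); `maxHeartbeats` precedent: `B11Eq117GaugeNormInvariance`, `B6Prop26MirrorAssemblyV1`
set_option maxHeartbeats 1600000 in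
/-- **COROLLARY 2.8 (2.150)–(2.151), VERBATIM (`B6.Cor28Printed (d+1)`), ON THE GENUINE k-LEVEL V1 FAMILY, MODULO THE DISPLAYED (2.137)₁ INPUT `h2137`**
(Prop. 2.6 (2.137)₁ at k levels for the genuine `G`, threshold uniform in the Hölder exponent — p22's programme; discharged in the sequel): the three entries
`|H(b,c)|`, `|(∇H)(b,c)|`, `‖(ζ∇H)(·,c)‖_α` of the genuine `H = GQ*(QGQ*)⁻¹` in print's kernel normalisation, fed by `B6Cor28EntriesKLevelV1.cor28_kLevel_H_DH`
and `B6Cor28HolderKLevelV1.cor28_kLevel_holderPair_of_2137` (σ := σ₁, rate `α_r := ½`; the thresholds are uniform in the Hölder exponent), the cut-off dressed by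
the product rule `B6HolderPairMemberV1.abs_cutoff_pair_le`, the localisation moved from the block of the first point to the census site by (2.54) and (2.60).
[cite: Balaban1984PropagatorsII, Cor. 2.8 (2.150)–(2.151) p.249, (2.54) p.232, (2.60) p.234] -/
theorem cor28Printed_kLevel_of_2137 (hb₀ : 0 < b₀) (hb₁ : b₀ ≤ b₁)
    (h2137 :
      ∃ σ₁ : ℝ, 0 < σ₁ ∧ ∀ (σ : ℝ), 0 < σ → σ ≤ σ₁ → ∀ (β : ℝ), 0 < β → β ≤ 1 → ∃ M₂ : ℝ, 0 < M₂ ∧ ∀ (α : ℝ), 0 ≤ α → α < 1 →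
      ∃ A : ℝ, 0 ≤ A ∧
      ∀ (m K : ℕ) {Mh k R : ℕ} {P' : Fin (d + 1) → ℕ}
        (hN : ∀ μ, N0 ℓ Mh k P' μ = (PV d ℓ m K hd hL).sitesPerDir 0) (D : TDomains d ℓ Mh k P' R) (hk : k ≤ m + K) (_ : 2 ≤ k)
        {a : ℕ} (_ : Mh = (ℓ + 1) ^ a) (_ : 8 ≤ Mh) (_ : 2 * (ℓ + 1) ^ 2 ≤ R) (_ : ∀ μ, 5 ≤ P' μ) (_ : 4 ≤ ℓ)
        (_ : ∀ c : ↥(cubes D.toDomains), Placed ℓ k P' c.1) (_ : M₂ ≤ ((ℓ : ℝ) + 1) * Mh)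
        {cf : ℝ} (hcf : cf ≠ 0) {w : BondIdx (domT hN D hk) → ℝ} (hw : ∀ i, 0 < w i) (_ : GlobalBand b₀ b₁ cf w)
        (ν : Fin (d + 1)) (x x' : PBond (PV d ℓ m K hd hL) 0), x.dir = x'.dir →
        supDist x.src x'.src ≤ (ℓ + 1) ^ (blkV1 hN D x).1.1 → supDist x.src x'.src ≤ (ℓ + 1) ^ (blkV1 hN D x').1.1 →
        HasMajorant (g := geomT D) (blkV1 hN D) (pairOp x x' * DV (P := PV d ℓ m K hd hL) ν cf * onFun (GE (domT hN D hk) hcf hw))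
            (fun y y' => A * ((((supDist x.src x'.src : ℕ) : ℝ) / (((ℓ + 1 : ℕ) : ℝ)) ^ (blkV1 hN D x).1.1) ^ α *
              ((geomT D).len y * |cf|⁻¹)) * Real.exp (-(delta3 β (2 * σ) * (geomT D).dist y y')))) :
    B6.Cor28Printed (d + 1) (fun i : KIdx d ℓ hd hL b₀ b₁ => kGeo i) (fun i => kH i) := by
  classical
  -- the two inputs at `σ := min σ₁ σ₁'`, rate `½`
  obtain ⟨σa, hσa, hA⟩ := cor28_kLevel_H_DH d ℓ hd hL hb₀ hb₁
  obtain ⟨σb, hσb, hB⟩ := cor28_kLevel_holderPair_of_2137 d ℓ hd hL hb₀ hb₁ h2137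
  obtain ⟨δa, Ca, Ma, Na, hδa, hCa, hMa, hEa⟩ := hA (min σa σb) (lt_min hσa hσb) (min_le_left _ _) (1 / 2) (by norm_num) (by norm_num)
  obtain ⟨δb, Mb, Nb, hδb, hMb, hHb⟩ := hB (min σa σb) (lt_min hσa hσb) (min_le_right _ _) (1 / 2) (by norm_num) (by norm_num)
  clear hA hB
  -- the Hölder constant as a function of `α` (junk outside `[0,1)`)
  set Cb : ℝ → ℝ := fun α => if h : 0 ≤ α ∧ α < 1 then Classical.choose (hHb α h.1 h.2) else 0 with hCbdef
  have hCb0 : ∀ α, 0 ≤ Cb α := by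
    intro α; simp only [hCbdef]
    split_ifs with h
    · exact (Classical.choose_spec (hHb α h.1 h.2)).1
    · exact le_rfl
  have hCbspec : ∀ α (h0 : 0 ≤ α) (h1 : α < 1), Cb α = Classical.choose (hHb α h0 h1) := by
    intro α h0 h1; simp only [hCbdef, dif_pos (And.intro h0 h1)]
  set δ₅ : ℝ := min δa δb with hδ₅
  have hδ₅pos : 0 < δ₅ := lt_min hδa hδb
  set KL : ℝ := (((ℓ : ℝ) + 1) ^ 2 * Real.exp 1) ^ 2 with hKL
  have hKL0 : 0 ≤ KL := by positivity
  refine ⟨max (max Ma Mb) (max ((Na : ℝ) + 1) ((Nb : ℝ) + 1)), δ₅, max Ca 1,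
    fun α => 2 * (max Ca (Cb α)) * KL * Real.exp δb, ?_, hδ₅pos, lt_max_of_lt_right one_pos, fun i _ hM => ?_⟩
  · exact lt_max_of_lt_left (lt_max_of_lt_left hMa)
  -- the thresholds of the index from the one printed threshold `M₁ ≤ M = L·M_h`
  have hM' : max (max Ma Mb) (max ((Na : ℝ) + 1) ((Nb : ℝ) + 1)) ≤ (((ℓ + 1 : ℕ) : ℝ)) * (i.Mh : ℝ) := hM
  have hcast : (((ℓ + 1 : ℕ) : ℝ)) = (ℓ : ℝ) + 1 := by push_cast; ring
  have hMa' : Ma ≤ ((ℓ : ℝ) + 1) * i.Mh := by rw [← hcast]; exact ((le_max_left _ _).trans (le_max_left _ _)).trans hM'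
  have hMb' : Mb ≤ ((ℓ : ℝ) + 1) * i.Mh := by rw [← hcast]; exact ((le_max_right _ _).trans (le_max_left _ _)).trans hM'
  have hR1 : 1 ≤ i.R := le_trans (Nat.one_le_two_pow) (le_trans (Nat.pow_le_pow_left (by omega : 2 ≤ ℓ + 1) 2 |>.trans
    (Nat.le_mul_of_pos_left _ (by norm_num))) i.hR2)
  have hthr : ∀ {N : ℕ}, ((N : ℝ) + 1) ≤ (((ℓ + 1 : ℕ) : ℝ)) * (i.Mh : ℝ) → N + 1 ≤ i.R * ((ℓ + 1) * i.Mh) := by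
    intro N h1
    have h2 : N + 1 ≤ (ℓ + 1) * i.Mh := by exact_mod_cast h1
    exact h2.trans (Nat.le_mul_of_pos_left _ hR1)
  have hNa' : Na + 1 ≤ i.R * ((ℓ + 1) * i.Mh) := hthr (((le_max_left _ _).trans (le_max_right _ _)).trans hM')
  have hNb' : Nb + 1 ≤ i.R * ((ℓ + 1) * i.Mh) := hthr (((le_max_right _ _).trans (le_max_right _ _)).trans hM')
  have hk1 : 1 ≤ i.k := le_trans one_le_two i.hk2
  have hMh1 : 1 ≤ i.Mh := le_trans (by norm_num) i.hM8
  have hP1 : ∀ μ, 1 ≤ i.P' μ := fun μ => le_trans (by norm_num) (i.hP5 μ)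
  have hRM2L : 2 * (ℓ + 1) ≤ i.R * ((ℓ + 1) * i.Mh) := by
    have h1 : 2 * (ℓ + 1) ≤ 2 * (ℓ + 1) ^ 2 := by nlinarith
    have h2 : 1 ≤ (ℓ + 1) * i.Mh := le_trans hMh1 (Nat.le_mul_of_pos_left _ (by omega))
    calc 2 * (ℓ + 1) ≤ 2 * (ℓ + 1) ^ 2 * 1 := by omega
      _ ≤ i.R * ((ℓ + 1) * i.Mh) := Nat.mul_le_mul i.hR2 h2
  have habs : 0 < |i.cf| := abs_pos.2 i.hcf
  -- the sup entries of the index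
  obtain ⟨hE0, hE1⟩ := hEa i.m i.K i.hN i.D i.hk i.hk2 i.hMha i.hM8 i.hR2 i.hP5 i.hℓ i.hpl hMa' hNa' i.hcf i.hw i.hwb
  have hvol0 : ∀ c, 0 < vol i c := fun c => by unfold vol; positivity
  -- rates
  have hrate : ∀ {δ : ℝ} (_ : δ₅ ≤ δ) (t : ℝ) (_ : 0 ≤ t), Real.exp (-(δ * t)) ≤ Real.exp (-(δ₅ * t)) :=
    fun hδ t ht => Real.exp_le_exp.2 (by nlinarith)
  refine ⟨fun n y c => ?_, fun α ζ y c hα0 hα1 hζ => ?_⟩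
  · -- THE SUP ENTRIES `|H(b,c)|`, `|(∇H)(b,c)|`
    have hRHS0 : 0 ≤ max Ca 1 * (kGeo i).len y ^ (-((n : ℕ) : ℝ)) * (kGeo i).len c ^ (-((d + 1 : ℕ) : ℝ)) *
        Real.exp (-(δ₅ * (kGeo i).dist y c)) := by
      have := len_pos i y; have := len_pos i c; positivity
    refine Real.iSup_le (fun ν => Real.iSup_le (fun f => ?_) hRHS0) hRHS0
    split_ifs with hf hn
    · -- `n = 0`: `|H(f,c)|·vol⁻¹ ≤ C·1·len c^{−D}·e^{−δ₅ d}`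
      subst hn
      have h := hE0 c f
      rw [hf] at h
      rw [len_rpow_neg_D]
      have e0 : (kGeo i).len y ^ (-(((0 : Fin 2) : ℕ) : ℝ)) = 1 := by simp
      rw [e0, mul_one]
      have hd0 := distT_nonneg (D := i.D) (β i.hN i.D i.hk y) (β i.hN i.D i.hk c)
      calc |Hfl i c f| * (vol i c)⁻¹ ≤ (Ca * Real.exp (-(δa * (geomT i.D).dist (β i.hN i.D i.hk y) (β i.hN i.D i.hk c)))) * (vol i c)⁻¹ :=
            mul_le_mul_of_nonneg_right h (inv_nonneg.2 (hvol0 c).le)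
        _ ≤ (max Ca 1 * Real.exp (-(δ₅ * (geomT i.D).dist (β i.hN i.D i.hk y) (β i.hN i.D i.hk c)))) * (vol i c)⁻¹ := by
            refine mul_le_mul_of_nonneg_right ?_ (inv_nonneg.2 (hvol0 c).le)
            exact mul_le_mul (le_max_left _ _) (hrate (min_le_left _ _) _ hd0) (Real.exp_pos _).le (hCa.trans (le_max_left _ _))
        _ = _ := by ring
    · -- `n = 1`: `|(∇_νH)(f,c)|·vol⁻¹ ≤ C·len y^{−1}·len c^{−D}·e^{−δ₅ d}`
      have hn1 : n = 1 := by
        rcases Fin.eq_zero_or_eq_succ n with h0 | ⟨j, hj⟩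
        · exact absurd h0 hn
        · rw [hj]; have := Fin.eq_zero j; subst this; rfl
      subst hn1
      have h := hE1 ν c f
      rw [hf] at h
      rw [len_rpow_neg_D]
      have e1 : (kGeo i).len y ^ (-(((1 : Fin 2) : ℕ) : ℝ)) = ((geomT i.D).len (β i.hN i.D i.hk y) * |i.cf|⁻¹)⁻¹ := by
        rw [show (-(((1 : Fin 2) : ℕ) : ℝ)) = -1 by simp, Real.rpow_neg_one, len_eq_lenT]
      rw [e1]
      have hd0 := distT_nonneg (D := i.D) (β i.hN i.D i.hk y) (β i.hN i.D i.hk c)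
      have hl0 : 0 ≤ ((geomT i.D).len (β i.hN i.D i.hk y) * |i.cf|⁻¹)⁻¹ :=
        inv_nonneg.2 (mul_nonneg (lenT_pos (D := i.D) _).le (inv_nonneg.2 habs.le))
      calc |DHfl i ν c f| * (vol i c)⁻¹
          ≤ (Ca * ((geomT i.D).len (β i.hN i.D i.hk y) * |i.cf|⁻¹)⁻¹ *
              Real.exp (-(δa * (geomT i.D).dist (β i.hN i.D i.hk y) (β i.hN i.D i.hk c)))) * (vol i c)⁻¹ :=
            mul_le_mul_of_nonneg_right h (inv_nonneg.2 (hvol0 c).le)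
        _ ≤ (max Ca 1 * ((geomT i.D).len (β i.hN i.D i.hk y) * |i.cf|⁻¹)⁻¹ *
              Real.exp (-(δ₅ * (geomT i.D).dist (β i.hN i.D i.hk y) (β i.hN i.D i.hk c)))) * (vol i c)⁻¹ := by
            refine mul_le_mul_of_nonneg_right ?_ (inv_nonneg.2 (hvol0 c).le)
            refine mul_le_mul (mul_le_mul_of_nonneg_right (le_max_left _ _) hl0) (hrate (min_le_left _ _) _ hd0)
              (Real.exp_pos _).le (mul_nonneg (hCa.trans (le_max_left _ _)) hl0)
        _ = _ := by ring
    · exact hRHS0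
  · -- THE HÖLDER ENTRY `‖(ζ∇H)(·,c)‖_α`
    have hspec := Classical.choose_spec (hHb α hα0 hα1)
    set C : ℝ := Classical.choose (hHb α hα0 hα1) with hCdef
    obtain ⟨hC, hP⟩ := hspec
    have hCle : C ≤ max Ca (Cb α) := by rw [hCbspec α hα0 hα1]; exact le_max_right _ _
    have hCale : Ca ≤ max Ca (Cb α) := le_max_left _ _
    set Cm : ℝ := max Ca (Cb α) with hCm
    have hCm0 : 0 ≤ Cm := hCa.trans hCale
    have hPair := hP i.m i.K i.hN i.D i.hk i.hk2 i.hMha i.hM8 i.hR2 i.hP5 i.hℓ i.hpl hMb' hNb' i.hcf i.hw i.hwb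
    clear hP
    -- notation
    set S1 : ℝ := ⨆ f : PBond (PV d ℓ i.m i.K hd hL) 0, |ζ f| with hS1
    set S2 : ℝ := ⨆ q : PBond (PV d ℓ i.m i.K hd hL) 0 × PBond (PV d ℓ i.m i.K hd hL) 0,
      if Adm i q.1 q.2 then tpar i q.1 q.2 ^ (-α) * |ζ q.1 - ζ q.2| else 0 with hS2
    have hS1_0 : 0 ≤ S1 := Real.iSup_nonneg fun f => abs_nonneg _
    have hS2_0 : 0 ≤ S2 := Real.iSup_nonneg fun q => by
      split_ifs
      · exact mul_nonneg (Real.rpow_nonneg (by unfold tpar; positivity) _) (abs_nonneg _)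
      · exact le_rfl
    have hcutH : (kGeo i).cutH α ζ = S1 + S2 := rfl
    have hζle : ∀ f, |ζ f| ≤ S1 := fun f => le_ciSup (f := fun f => |ζ f|) (Set.finite_range _).bddAbove f
    have hζ2 : ∀ x x', Adm i x x' → tpar i x x' ^ (-α) * |ζ x - ζ x'| ≤ S2 := by
      intro x x' hadm
      have := le_ciSup (f := fun q : PBond (PV d ℓ i.m i.K hd hL) 0 × PBond (PV d ℓ i.m i.K hd hL) 0 =>
        if Adm i q.1 q.2 then tpar i q.1 q.2 ^ (-α) * |ζ q.1 - ζ q.2| else 0) (Set.finite_range _).bddAbove (x, x')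
      simp only [if_pos hadm] at this
      exact this
    set ly : ℝ := (kGeo i).len y with hly
    have hly0 : 0 < ly := len_pos i y
    have hlyT : ly = (geomT i.D).len (β i.hN i.D i.hk y) * |i.cf|⁻¹ := len_eq_lenT i y
    -- the target
    have hRHS0 : 0 ≤ 2 * Cm * KL * Real.exp δb * ly ^ (-(1 + α)) * (S1 + S2) * (kGeo i).len c ^ (-((d + 1 : ℕ) : ℝ)) *
        Real.exp (-(δ₅ * (kGeo i).dist y c)) := by
      have := len_pos i c; positivity
    refine Real.iSup_le (fun ν => Real.iSup_le (fun q => ?_) hRHS0) hRHS0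
    obtain ⟨x, x'⟩ := q
    simp only
    split_ifs with hadm
    swap
    · exact hRHS0
    -- an admissible pair `(x, x′)`
    obtain ⟨hdir, hs1, hs2⟩ := hadm
    have hadm' : Adm i x' x := ⟨hdir.symm, by rw [supDist_comm]; exact hs2, by rw [supDist_comm]; exact hs1⟩
    set F : PBond (PV d ℓ i.m i.K hd hL) 0 → ℝ := fun f => DHfl i ν c f with hF
    -- the pointwise bounds at a block `z` adjacent to `β y`, moved to the census site
    have hmove : ∀ z : ↥(bset i.D.toDomains), (geomT i.D).dist z (β i.hN i.D i.hk y) ≤ 1 →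
        ((geomT i.D).len z * |i.cf|⁻¹) ^ (-α) * ((geomT i.D).len z * |i.cf|⁻¹)⁻¹ * Real.exp (-(δ₅ * (geomT i.D).dist z (β i.hN i.D i.hk c))) ≤
          KL * Real.exp δb * (ly ^ (-(1 + α)) * Real.exp (-(δ₅ * (kGeo i).dist y c))) := by
      intro z hz
      have h1 := adjLen_le i.D hMh1 hP1 hRM2L i.hcf hα0 hα1.le (β i.hN i.D i.hk y) z hz
      have h2 := exp_adj_le i.D hMh1 hP1 hδ₅pos.le (β i.hN i.D i.hk y) z (β i.hN i.D i.hk c) hz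
      have h3 : Real.exp δ₅ ≤ Real.exp δb := Real.exp_le_exp.2 (min_le_right _ _)
      rw [← hlyT] at h1
      have hEz0 : 0 ≤ Real.exp (-(δ₅ * (geomT i.D).dist z (β i.hN i.D i.hk c))) := (Real.exp_pos _).le
      calc ((geomT i.D).len z * |i.cf|⁻¹) ^ (-α) * ((geomT i.D).len z * |i.cf|⁻¹)⁻¹ * Real.exp (-(δ₅ * (geomT i.D).dist z (β i.hN i.D i.hk c)))
          ≤ (KL * ly ^ (-(1 + α))) * (Real.exp δ₅ * Real.exp (-(δ₅ * (geomT i.D).dist (β i.hN i.D i.hk y) (β i.hN i.D i.hk c)))) :=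
            mul_le_mul h1 h2 hEz0 (by positivity)
        _ ≤ (KL * ly ^ (-(1 + α))) * (Real.exp δb * Real.exp (-(δ₅ * (geomT i.D).dist (β i.hN i.D i.hk y) (β i.hN i.D i.hk c)))) := by
            gcongr
        _ = _ := by ring
    -- entry bound at a fine bond `f`: `|F f| ≤ Cm·ℓ_f⁻¹·Ec(y_f)`
    have hEnt : ∀ f, |F f| ≤ Cm * ((geomT i.D).len (blkV1 i.hN i.D f) * |i.cf|⁻¹)⁻¹ * Real.exp (-(δ₅ * (geomT i.D).dist (blkV1 i.hN i.D f) (β i.hN i.D i.hk c))) := by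
      intro f
      have h := hE1 ν c f
      have hl0 : 0 ≤ ((geomT i.D).len (blkV1 i.hN i.D f) * |i.cf|⁻¹)⁻¹ :=
        inv_nonneg.2 (mul_nonneg (lenT_pos (D := i.D) _).le (inv_nonneg.2 habs.le))
      refine h.trans ?_
      exact mul_le_mul (mul_le_mul_of_nonneg_right hCale hl0) (hrate (min_le_left _ _) _ (distT_nonneg _ _))
        (Real.exp_pos _).le (mul_nonneg hCm0 hl0)
    -- pair bound for an admissible ordered pair `(u, u′)`: `|F u − F u′| ≤ Cm·t^α·ℓ_u⁻¹·Ec(y_u)`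
    have hPr : ∀ u u', Adm i u u' → |F u - F u'| ≤ Cm * (tpar i u u' ^ α * ((geomT i.D).len (blkV1 i.hN i.D u) * |i.cf|⁻¹)⁻¹) *
        Real.exp (-(δ₅ * (geomT i.D).dist (blkV1 i.hN i.D u) (β i.hN i.D i.hk c))) := by
      intro u u' ⟨hd', h1', h2'⟩
      have h := hPair ν u u' hd' h1' h2' c
      have hl0 : 0 ≤ tpar i u u' ^ α * ((geomT i.D).len (blkV1 i.hN i.D u) * |i.cf|⁻¹)⁻¹ :=
        mul_nonneg (Real.rpow_nonneg (by unfold tpar; positivity) _)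
          (inv_nonneg.2 (mul_nonneg (lenT_pos (D := i.D) _).le (inv_nonneg.2 habs.le)))
      refine h.trans ?_
      exact mul_le_mul (mul_le_mul_of_nonneg_right hCle hl0) (hrate (min_le_right _ _) _ (distT_nonneg _ _))
        (Real.exp_pos _).le (mul_nonneg hCm0 hl0)
    -- the quotient factor `(s·η)^{−α} = t^{−α}·ℓ_u^{−α}` for either end `u` of the pair
    have hquot : ∀ u : PBond (PV d ℓ i.m i.K hd hL) 0,
        (((supDist x.src x'.src : ℕ) : ℝ) * |i.cf|⁻¹) = (((supDist x.src x'.src : ℕ) : ℝ) / (((ℓ + 1 : ℕ) : ℝ)) ^ (blkV1 i.hN i.D u).1.1) * ((geomT i.D).len (blkV1 i.hN i.D u) * |i.cf|⁻¹) := by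
      intro u
      rw [lenT_eq]
      have hLp : (0 : ℝ) < (((ℓ + 1 : ℕ) : ℝ)) ^ (blkV1 i.hN i.D u).1.1 := by positivity
      have hc' : (((ℓ + 1 : ℕ) : ℝ)) = (ℓ : ℝ) + 1 := by push_cast; ring
      rw [hc'] at hLp ⊢
      field_simp
    -- CASE ANALYSIS on the support of `ζ` at the two points
    rcases Nat.eq_zero_or_pos (supDist x.src x'.src) with hs0 | hspos
    · -- `x = x′`: the term vanishes
      have hxx : x = x' := eq_of_supDist_eq_zero hdir hs0
      subst hxx
      simp only [sub_self, abs_zero, mul_zero, zero_mul]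
      exact hRHS0
    have hsR : (0 : ℝ) < ((supDist x.src x'.src : ℕ) : ℝ) := by exact_mod_cast hspos
    have htx : 0 < tpar i x x' := by unfold tpar; positivity
    have htx' : 0 < tpar i x' x := by unfold tpar; rw [supDist_comm]; positivity
    -- the common final step: a bound `Cm·(S1+S2)·ℓ_z^{−α}ℓ_z⁻¹·Real.exp (-(δ₅ * (geomT i.D).dist z (β i.hN i.D i.hk c)))` at an adjacent block `z` gives the target
    have hfinal : ∀ z : ↥(bset i.D.toDomains), (geomT i.D).dist z (β i.hN i.D i.hk y) ≤ 1 →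
        ∀ T : ℝ, T ≤ 2 * Cm * (S1 + S2) * (((geomT i.D).len z * |i.cf|⁻¹) ^ (-α) * ((geomT i.D).len z * |i.cf|⁻¹)⁻¹ * Real.exp (-(δ₅ * (geomT i.D).dist z (β i.hN i.D i.hk c)))) →
        T * (vol i c)⁻¹ ≤ 2 * Cm * KL * Real.exp δb * ly ^ (-(1 + α)) * (S1 + S2) * (kGeo i).len c ^ (-((d + 1 : ℕ) : ℝ)) *
          Real.exp (-(δ₅ * (kGeo i).dist y c)) := by
      intro z hz T hT
      rw [len_rpow_neg_D]
      have hm := hmove z hz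
      have h1 : T ≤ 2 * Cm * (S1 + S2) * (KL * Real.exp δb * (ly ^ (-(1 + α)) * Real.exp (-(δ₅ * (kGeo i).dist y c)))) :=
        hT.trans (mul_le_mul_of_nonneg_left hm (by positivity))
      calc T * (vol i c)⁻¹ ≤ (2 * Cm * (S1 + S2) * (KL * Real.exp δb * (ly ^ (-(1 + α)) * Real.exp (-(δ₅ * (kGeo i).dist y c))))) * (vol i c)⁻¹ :=
            mul_le_mul_of_nonneg_right h1 (inv_nonneg.2 (hvol0 c).le)
        _ = _ := by ring
    by_cases hzx : ζ x = 0
    · by_cases hzx' : ζ x' = 0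
      · -- both vanish
        rw [hzx, hzx']; simp only [zero_mul, sub_self, abs_zero, mul_zero]; exact hRHS0
      · -- `ζ(x) = 0 ≠ ζ(x′)`: `|ζ(x′)F(x′)| = |ζ(x′) − ζ(x)|·|F(x′)|`, the REVERSED pair `(x′, x)` at the block of `x′`
        have hz' : (geomT i.D).dist (blkV1 i.hN i.D x') (β i.hN i.D i.hk y) ≤ 1 := hζ x' hzx'
        refine hfinal _ hz' _ ?_
        rw [hzx, zero_mul, zero_sub, abs_neg, abs_mul]
        have hζd : |ζ x'| ≤ tpar i x' x ^ α * S2 := by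
          have h := hζ2 x' x hadm'
          rw [hzx, sub_zero] at h
          calc |ζ x'| = tpar i x' x ^ α * (tpar i x' x ^ (-α) * |ζ x'|) := by
                rw [← mul_assoc, Real.rpow_neg htx'.le, mul_inv_cancel₀ (Real.rpow_pos_of_pos htx' α).ne', one_mul]
            _ ≤ tpar i x' x ^ α * S2 := mul_le_mul_of_nonneg_left h (Real.rpow_nonneg htx'.le _)
        have hq := hquot x'
        have hsc : supDist x'.src x.src = supDist x.src x'.src := supDist_comm _ _
        have hl0 : 0 ≤ (geomT i.D).len (blkV1 i.hN i.D x') * |i.cf|⁻¹ := mul_nonneg (lenT_pos (D := i.D) _).le (inv_nonneg.2 habs.le)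
        calc (((supDist x.src x'.src : ℕ) : ℝ) * |i.cf|⁻¹) ^ (-α) * (|ζ x'| * |F x'|)
            ≤ (((supDist x.src x'.src : ℕ) : ℝ) * |i.cf|⁻¹) ^ (-α) * ((tpar i x' x ^ α * S2) * (Cm * ((geomT i.D).len (blkV1 i.hN i.D x') * |i.cf|⁻¹)⁻¹ * Real.exp (-(δ₅ * (geomT i.D).dist (blkV1 i.hN i.D x') (β i.hN i.D i.hk c))))) :=
              mul_le_mul_of_nonneg_left (mul_le_mul hζd (hEnt x') (abs_nonneg _) (by positivity)) (Real.rpow_nonneg (by positivity) _)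
          _ = (tpar i x' x * ((geomT i.D).len (blkV1 i.hN i.D x') * |i.cf|⁻¹)) ^ (-α) *
                (tpar i x' x ^ α * (S2 * Cm * ((geomT i.D).len (blkV1 i.hN i.D x') * |i.cf|⁻¹)⁻¹ * Real.exp (-(δ₅ * (geomT i.D).dist (blkV1 i.hN i.D x') (β i.hN i.D i.hk c))))) := by
              rw [hq]; unfold tpar; rw [hsc]; ring
          _ = ((geomT i.D).len (blkV1 i.hN i.D x') * |i.cf|⁻¹) ^ (-α) *
                (S2 * Cm * ((geomT i.D).len (blkV1 i.hN i.D x') * |i.cf|⁻¹)⁻¹ * Real.exp (-(δ₅ * (geomT i.D).dist (blkV1 i.hN i.D x') (β i.hN i.D i.hk c)))) := quot_cancel htx' hl0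
          _ ≤ 2 * Cm * (S1 + S2) * (((geomT i.D).len (blkV1 i.hN i.D x') * |i.cf|⁻¹) ^ (-α) *
                ((geomT i.D).len (blkV1 i.hN i.D x') * |i.cf|⁻¹)⁻¹ * Real.exp (-(δ₅ * (geomT i.D).dist (blkV1 i.hN i.D x') (β i.hN i.D i.hk c)))) := by
              have hA0 : 0 ≤ ((geomT i.D).len (blkV1 i.hN i.D x') * |i.cf|⁻¹) ^ (-α) * ((geomT i.D).len (blkV1 i.hN i.D x') * |i.cf|⁻¹)⁻¹ *
                  Real.exp (-(δ₅ * (geomT i.D).dist (blkV1 i.hN i.D x') (β i.hN i.D i.hk c))) := by positivity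
              have : S2 * Cm ≤ 2 * Cm * (S1 + S2) := by nlinarith
              calc _ = (S2 * Cm) * (((geomT i.D).len (blkV1 i.hN i.D x') * |i.cf|⁻¹) ^ (-α) *
                    ((geomT i.D).len (blkV1 i.hN i.D x') * |i.cf|⁻¹)⁻¹ * Real.exp (-(δ₅ * (geomT i.D).dist (blkV1 i.hN i.D x') (β i.hN i.D i.hk c)))) := by ring
                _ ≤ _ := mul_le_mul_of_nonneg_right this hA0
    · -- `ζ(x) ≠ 0`: the product rule, both terms at the block of `x`
      have hz : (geomT i.D).dist (blkV1 i.hN i.D x) (β i.hN i.D i.hk y) ≤ 1 := hζ x hzx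
      refine hfinal _ hz _ ?_
      have hprod := abs_cutoff_pair_le ζ F x x'
      have hζd : |ζ x - ζ x'| ≤ tpar i x x' ^ α * S2 := by
        have h := hζ2 x x' ⟨hdir, hs1, hs2⟩
        calc |ζ x - ζ x'| = tpar i x x' ^ α * (tpar i x x' ^ (-α) * |ζ x - ζ x'|) := by
              rw [← mul_assoc, Real.rpow_neg htx.le, mul_inv_cancel₀ (Real.rpow_pos_of_pos htx α).ne', one_mul]
          _ ≤ tpar i x x' ^ α * S2 := mul_le_mul_of_nonneg_left h (Real.rpow_nonneg htx.le _)
      have hq := hquot x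
      have hl0 : 0 ≤ (geomT i.D).len (blkV1 i.hN i.D x) * |i.cf|⁻¹ := mul_nonneg (lenT_pos (D := i.D) _).le (inv_nonneg.2 habs.le)
      set lx : ℝ := (geomT i.D).len (blkV1 i.hN i.D x) * |i.cf|⁻¹ with hlx
      have hT1 : |ζ x'| * |F x - F x'| ≤ S1 * (Cm * (tpar i x x' ^ α * lx⁻¹) * Real.exp (-(δ₅ * (geomT i.D).dist (blkV1 i.hN i.D x) (β i.hN i.D i.hk c)))) :=
        mul_le_mul (hζle x') (hPr x x' ⟨hdir, hs1, hs2⟩) (abs_nonneg _) hS1_0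
      have hT2 : |ζ x - ζ x'| * |F x| ≤ (tpar i x x' ^ α * S2) * (Cm * lx⁻¹ * Real.exp (-(δ₅ * (geomT i.D).dist (blkV1 i.hN i.D x) (β i.hN i.D i.hk c)))) :=
        mul_le_mul hζd (hEnt x) (abs_nonneg _) (by positivity)
      calc (((supDist x.src x'.src : ℕ) : ℝ) * |i.cf|⁻¹) ^ (-α) * |ζ x * F x - ζ x' * F x'|
          ≤ (((supDist x.src x'.src : ℕ) : ℝ) * |i.cf|⁻¹) ^ (-α) * (S1 * (Cm * (tpar i x x' ^ α * lx⁻¹) * Real.exp (-(δ₅ * (geomT i.D).dist (blkV1 i.hN i.D x) (β i.hN i.D i.hk c)))) +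
              (tpar i x x' ^ α * S2) * (Cm * lx⁻¹ * Real.exp (-(δ₅ * (geomT i.D).dist (blkV1 i.hN i.D x) (β i.hN i.D i.hk c))))) :=
            mul_le_mul_of_nonneg_left (hprod.trans (add_le_add hT1 hT2)) (Real.rpow_nonneg (by positivity) _)
        _ = (tpar i x x' * lx) ^ (-α) * (tpar i x x' ^ α * ((S1 + S2) * Cm * lx⁻¹ * Real.exp (-(δ₅ * (geomT i.D).dist (blkV1 i.hN i.D x) (β i.hN i.D i.hk c))))) := by
            rw [hq]; unfold tpar; ring
        _ = lx ^ (-α) * ((S1 + S2) * Cm * lx⁻¹ * Real.exp (-(δ₅ * (geomT i.D).dist (blkV1 i.hN i.D x) (β i.hN i.D i.hk c)))) := quot_cancel htx hl0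
        _ ≤ 2 * Cm * (S1 + S2) * (lx ^ (-α) * lx⁻¹ * Real.exp (-(δ₅ * (geomT i.D).dist (blkV1 i.hN i.D x) (β i.hN i.D i.hk c)))) := by
            have hA0 : 0 ≤ lx ^ (-α) * lx⁻¹ * Real.exp (-(δ₅ * (geomT i.D).dist (blkV1 i.hN i.D x) (β i.hN i.D i.hk c))) := by positivity
            have : (S1 + S2) * Cm ≤ 2 * Cm * (S1 + S2) := by nlinarith
            calc _ = ((S1 + S2) * Cm) * (lx ^ (-α) * lx⁻¹ * Real.exp (-(δ₅ * (geomT i.D).dist (blkV1 i.hN i.D x) (β i.hN i.D i.hk c)))) := by ring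
              _ ≤ _ := mul_le_mul_of_nonneg_right this hA0

/-! ## §4  Non-vacuity at `L = 5`

For every census threshold `M₁`, every `k ≥ 2` and every band there is an index of the family with `M₁ ≤ M = L·M_h`:
`B6Prop27PrintedKLevelV1.kLevel27_meets_hypotheses` (not re-exported here — the gate's dedup rule). -/

end Literature.MathematicalPhysics.QuantumFieldTheory.Balaban1983to89.B6Cor28PrintedKLevelV1

end
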